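import Summits.CriticalPhenomena.Ising3D.IsingColumnFaceL11CensusRadiiCoreTrg
import Literature.Analysis.SpecialFunctions.LogTwoBounds

/-!
# The catalogue census of §7.3 as kernel facts, IX: the distinct-values machine, part 1 — generic tagged
sort with permutation, and the separation chains (cell `pub-ising3x`, seat recog-1; paper §1.6 / §7.3;
companion of parts VI–VIII `…CensusRadii*` (covering radii) and of the §7.3 census machines
`…CensusSegmentLin*` / `…CensusSegmentTrg*` (description counts))

HONEST FRAMING: lottery ticket; floor = tightest certified 3D Ising CFT bounds; no exact-solution
claim without a proof. Island framing: certified exclusion region at stated derivative order and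
assumptions; not a determination of the 3D Ising critical exponents beyond that.

§7.3 (paper of record v1.40) prints the censuses of the two transcendental catalogue tables on the certified
`Δε`-segment `[81/64, 2855/2048]` as counts of DESCRIPTIONS — `112 660` primitive `LIN` tuples `(a₀, c, aₓ)`
(`lin_descr_segment_ncard`), `39 339` canonical lowest-terms `TRG` tuples (`trg_descr_segment_ncard`) — and every
recog offer since O-g50-1 files «distinct-value counts: NOT CLAIMED» (two descriptions could in principle take the
same value through an unknown relation among `π, log 2, ζ(3), ζ(5), G, Γ(¼), Γ(⅓)`). For THIS finite table on
THIS segment the question is decidable by the certified enclosures: sort all enclosures and check that consecutive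
ones are strictly separated. This module is the generic half of that machine:
* tagged enclosures `(lo, hi, tag)` (`Enc`), a bottom-up merge sort `msortT` by lower end WITH the permutation
  theorem `msortT_perm` (the covering machine's `msortN` only has `⊆`; distinctness needs that nothing is dropped
  or duplicated);
* the chain checks `gapChain δ` (every enclosure well-formed, consecutive ones at least `δ` apart) and
  `crossChain δ` (consecutive enclosures of DIFFERENT tags at least `δ` apart) with their soundness: a passed
  `gapChain` gives the inequality for EVERY ordered pair (`gapChain_pairwise`), a passed `crossChain` on an
  ordered list gives it for every mixed pair (`crossChain_pairwise`, the tag-switch argument); `rel_or_rel_of_pairwise`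
  (any two distinct members are related one way or the other) and `nodup_of_gapChain`.
The unit `distU = 10¹⁸·lcm(1..32)` (common to `LIN`, `aₓ ≤ 12`, and `TRG`, `q ≤ 32`) and the tagged scaled enclosure
`linEncOf` of a `LIN` tuple over `linZEnclT` = the landed scaled enclosures `linZEncl` / `kZ` of `ExclusionSentencesLin` with
the `log 2` entry read at twenty digits from the tree's `LogTwoBounds` (`kZT`; `LIN` against `LIN` would separate at the landed
ten-digit `log 2`, `LIN` against `TRG` does not: a `±12·10⁻¹⁰`-wide `LIN` enclosure swallows nearby `TRG` values) close the file
(`kZT_sound`, `linZEnclT_sound`, `distU_mul_linVal`, `linEncOf_sound`; the tag `2` marks the `TRG`-form tuples `linIsTrg`).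
The `LIN` / `TRG` tuple generators with soundness AND completeness, the part check and the theorems are in
`…DistinctCoreLin.lean`, `…DistinctCoreTrg.lean`, `…DistinctP*.lean`, `…DistinctLin.lean`, `…DistinctTrg.lean`.
Two kernel-cost facts fixed the shape of the machine (recog-1 gen 53 TIMINGS.md): the kernel evaluates a list once per consumer, so
every check consumes each generated list exactly once (`gapCrossChain`), and a FALSE heavy `decide` does not fail cleanly but exhausts
lean's `--memory` budget on the diagnosis path — the design twin and the Lean generators must read the SAME enclosure tables, and
every kernel proposition is `#eval`-checked before it is filed.
Pure list combinatorics plus the `LIN` enclosure table; no certificate, no datum, no σ–ε axiom; nothing is recognised (§1.6); no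
P(M·) relevance.
lottery ticket; floor = tightest certified 3D Ising CFT bounds; no exact-solution claim without a proof.
-/

namespace Summit.CriticalPhenomena.Ising3D
namespace ColumnFaceL11

/-! ### Generic: tagged enclosures, merge sort by lower end, permutation -/

/-- A tagged scaled enclosure `(lo, hi, tag)` (`tag = 0`: a `LIN` value; `tag = 1`: a `TRG` value). [folklore] -/
abbrev Enc : Type := ℕ × ℕ × ℕ

/-- Merge two lists of tagged enclosures by lower end (fuel `n`; with fuel `0` the rest is appended, so the
output is ALWAYS a permutation of the inputs). [folklore] -/
def mergeT : ℕ → List Enc → List Enc → List Enc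
  | 0, l₁, l₂ => l₁ ++ l₂
  | _ + 1, [], l₂ => l₂
  | _ + 1, a :: l₁, [] => a :: l₁
  | n + 1, a :: l₁, b :: l₂ =>
      if a.1 ≤ b.1 then a :: mergeT n l₁ (b :: l₂) else b :: mergeT n (a :: l₁) l₂

/-- `mergeT n l₁ l₂` is a permutation of `l₁ ++ l₂`. [folklore] -/
theorem mergeT_perm : ∀ (n : ℕ) (l₁ l₂ : List Enc), (mergeT n l₁ l₂).Perm (l₁ ++ l₂)
  | 0, l₁, l₂ => by rw [mergeT]
  | n + 1, [], l₂ => by rw [mergeT, List.nil_append]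
  | n + 1, a :: l₁, [] => by rw [mergeT, List.append_nil]
  | n + 1, a :: l₁, b :: l₂ => by
      simp only [mergeT]
      split_ifs with hab
      · exact (mergeT_perm n l₁ (b :: l₂)).cons a
      · exact ((mergeT_perm n (a :: l₁) l₂).cons b).trans List.perm_middle.symm

/-- One bottom-up pass: merge adjacent runs. [folklore] -/
def mergePassT (n : ℕ) : List (List Enc) → List (List Enc)
  | [] => []
  | [r] => [r]
  | r₁ :: r₂ :: rs => mergeT n r₁ r₂ :: mergePassT n rs

/-- A pass permutes the concatenation. [folklore] -/
theorem mergePassT_perm (n : ℕ) : ∀ (rs : List (List Enc)), (mergePassT n rs).flatten.Perm rs.flatten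
  | [] => by rw [mergePassT]
  | [r] => by rw [mergePassT]
  | r₁ :: r₂ :: rs => by
      simp only [mergePassT, List.flatten_cons, ← List.append_assoc]
      exact (mergeT_perm n r₁ r₂).append (mergePassT_perm n rs)

/-- Iterate the passes (fuel `k`) until one run is left. [folklore] -/
def mergeAllT (n : ℕ) : ℕ → List (List Enc) → List Enc
  | 0, rs => rs.flatten
  | k + 1, rs =>
    match rs with
    | [] => []
    | [r] => r
    | r₁ :: r₂ :: rs' => mergeAllT n k (mergePassT n (r₁ :: r₂ :: rs'))

/-- `mergeAllT` permutes the concatenation. [folklore] -/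
theorem mergeAllT_perm (n : ℕ) : ∀ (k : ℕ) (rs : List (List Enc)), (mergeAllT n k rs).Perm rs.flatten
  | 0, rs => by rw [mergeAllT]
  | k + 1, [] => by simp [mergeAllT]
  | k + 1, [r] => by simp [mergeAllT]
  | k + 1, r₁ :: r₂ :: rs' => by
      simp only [mergeAllT]
      exact (mergeAllT_perm n k _).trans (mergePassT_perm n _)

/-- Bottom-up merge sort of tagged enclosures by lower end (constant fuels `10⁷` merge steps / `40` passes,
enough for any list of length `< 10⁷`; correctness of the ORDER is never used — only the chains below, which are
checked on the output, and the permutation property). [folklore] -/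
def msortT (l : List Enc) : List Enc := mergeAllT 10000000 40 (l.map fun x => [x])

/-- The singleton runs concatenate back to the list. [folklore] -/
theorem flatten_map_singleton (l : List Enc) : (l.map fun x => [x]).flatten = l := by
  induction l with
  | nil => rfl
  | cons a l ih => simp [ih]

/-- **`msortT l` is a permutation of `l`.** [folklore] -/
theorem msortT_perm (l : List Enc) : (msortT l).Perm l := by
  have h := mergeAllT_perm 10000000 40 (l.map fun x => [x])
  rwa [flatten_map_singleton] at h

/-! ### Generic: the chain checks and their pairwise meaning -/

/-- `gapChain δ L`: every enclosure of `L` is well-formed (`lo ≤ hi`) and each consecutive pair is at least `δ`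
apart (`hi + δ ≤ lo'`). [folklore] -/
def gapChain (d : ℕ) : List Enc → Bool
  | [] => true
  | [a] => decide (a.1 ≤ a.2.1)
  | a :: b :: rest => decide (a.1 ≤ a.2.1) && decide (a.2.1 + d ≤ b.1) && gapChain d (b :: rest)

/-- **Soundness of `gapChain`**: well-formedness, and the gap inequality for EVERY ordered pair of the list
(transitivity through `lo ≤ hi`). [folklore] -/
theorem gapChain_pairwise {d : ℕ} : ∀ {L : List Enc}, gapChain d L = true →
    (∀ e ∈ L, e.1 ≤ e.2.1) ∧ L.Pairwise (fun a b => a.2.1 + d ≤ b.1)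
  | [], _ => by simp
  | [a], h => by
      simp only [gapChain, decide_eq_true_eq] at h
      simp [h]
  | a :: b :: rest, h => by
      simp only [gapChain, Bool.and_eq_true, decide_eq_true_eq] at h
      obtain ⟨⟨ha, hab⟩, hrest⟩ := h
      obtain ⟨hwf, hpw⟩ := gapChain_pairwise hrest
      refine ⟨?_, ?_⟩
      · intro e he
        rcases List.mem_cons.mp he with rfl | he
        · exact ha
        · exact hwf e he
      · rw [List.pairwise_cons]
        refine ⟨fun x hx => ?_, hpw⟩
        rcases List.mem_cons.mp hx with rfl | hx
        · exact hab
        · have hbx : b.2.1 + d ≤ x.1 := List.rel_of_pairwise_cons hpw hx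
          have hb : b.1 ≤ b.2.1 := hwf b List.mem_cons_self
          omega

/-- `crossChain δ L`: each consecutive pair of DIFFERENT tags is at least `δ` apart. [folklore] -/
def crossChain (d : ℕ) : List Enc → Bool
  | [] => true
  | [_] => true
  | a :: b :: rest => (decide (a.2.2 = b.2.2) || decide (a.2.1 + d ≤ b.1)) && crossChain d (b :: rest)

/-- **Soundness of `crossChain`** on a well-formed, ordered list (every earlier `hi` ≤ every later `lo`): the
gap inequality for EVERY mixed ordered pair (tag-switch argument: between two members of different tags some
consecutive pair switches tag). [folklore] -/
theorem crossChain_pairwise {d : ℕ} : ∀ {L : List Enc}, crossChain d L = true → (∀ e ∈ L, e.1 ≤ e.2.1) →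
    L.Pairwise (fun a b => a.2.1 ≤ b.1) → L.Pairwise (fun a b => a.2.2 ≠ b.2.2 → a.2.1 + d ≤ b.1)
  | [], _, _, _ => List.Pairwise.nil
  | [a], _, _, _ => List.pairwise_singleton _ _
  | a :: b :: rest, h, hwf, hord => by
      simp only [crossChain, Bool.and_eq_true, Bool.or_eq_true, decide_eq_true_eq] at h
      obtain ⟨hab, hrest⟩ := h
      have hwf' : ∀ e ∈ b :: rest, e.1 ≤ e.2.1 := fun e he => hwf e (List.mem_cons_of_mem _ he)
      have hord' := List.Pairwise.of_cons hord
      have ih := crossChain_pairwise hrest hwf' hord'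
      rw [List.pairwise_cons]
      refine ⟨fun x hx hne => ?_, ih⟩
      rcases List.mem_cons.mp hx with rfl | hx
      · rcases hab with hab | hab
        · exact absurd hab hne
        · exact hab
      · have hb : b.1 ≤ b.2.1 := hwf' b List.mem_cons_self
        have hbx : b.2.1 ≤ x.1 := List.rel_of_pairwise_cons hord' hx
        by_cases htag : a.2.2 = b.2.2
        · have hne' : b.2.2 ≠ x.2.2 := by rw [← htag]; exact hne
          have h2 : b.2.1 + d ≤ x.1 := List.rel_of_pairwise_cons ih hx hne'
          have h1 : a.2.1 ≤ b.1 := List.rel_of_pairwise_cons hord List.mem_cons_self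
          omega
        · rcases hab with hab | hab
          · exact absurd hab htag
          · omega

/-- `gapCrossChain δ δ' L`: `gapChain δ` and `crossChain δ'` in ONE pass over the list (the kernel evaluates a list it is
handed once per pass; two passes over the same expensive list cost twice). [folklore] -/
def gapCrossChain (d d' : ℕ) : List Enc → Bool
  | [] => true
  | [a] => decide (a.1 ≤ a.2.1)
  | a :: b :: rest => decide (a.1 ≤ a.2.1) && decide (a.2.1 + d ≤ b.1) &&
      (decide (a.2.2 = b.2.2) || decide (a.2.1 + d' ≤ b.1)) && gapCrossChain d d' (b :: rest)

/-- A passed `gapCrossChain` is a passed `gapChain` and a passed `crossChain`. [folklore] -/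
theorem gapCrossChain_split {d d' : ℕ} : ∀ {L : List Enc}, gapCrossChain d d' L = true →
    gapChain d L = true ∧ crossChain d' L = true
  | [], _ => by simp [gapChain, crossChain]
  | [a], h => by simpa [gapCrossChain, gapChain, crossChain] using h
  | a :: b :: rest, h => by
      simp only [gapCrossChain, Bool.and_eq_true] at h
      obtain ⟨⟨⟨h1, h2⟩, h3⟩, h4⟩ := h
      obtain ⟨ih1, ih2⟩ := gapCrossChain_split h4
      constructor
      · simp only [gapChain, Bool.and_eq_true]; exact ⟨⟨h1, h2⟩, ih1⟩
      · simp only [crossChain, Bool.and_eq_true]; exact ⟨h3, ih2⟩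

/-- From a pairwise relation on a list to any two distinct members, in one order or the other. [folklore] -/
theorem rel_or_rel_of_pairwise {R : Enc → Enc → Prop} {L : List Enc} (h : L.Pairwise R) {x y : Enc}
    (hx : x ∈ L) (hy : y ∈ L) (hne : x ≠ y) : R x y ∨ R y x := by
  have hs : L.Pairwise (fun a b => R a b ∨ R b a) := h.imp (fun hab => Or.inl hab)
  haveI : Std.Symm (fun a b : Enc => R a b ∨ R b a) := ⟨fun _ _ hab => hab.symm⟩
  exact hs.forall hx hy hne

/-- A list whose consecutive enclosures are strictly separated (`gapChain` with `δ ≥ 1`) has no duplicates.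
[folklore] -/
theorem nodup_of_gapChain {d : ℕ} (hd : 1 ≤ d) {L : List Enc} (h : gapChain d L = true) : L.Nodup := by
  obtain ⟨hwf, hpw⟩ := gapChain_pairwise h
  have key : L.Pairwise (fun a b => a ≠ b) := by
    refine List.Pairwise.imp_of_mem ?_ hpw
    intro a b ha _ hab heq
    subst heq
    have := hwf a ha
    omega
  exact key

/-! ### Units and the `LIN` enclosure of a tuple -/

/-- The unit of the distinct-values machine: `distU = 10¹⁸ · lcm(1, …, 32)` (common to `LIN`, `aₓ ≤ 12`, and
`TRG`, `q ≤ 32`). [folklore] -/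
def distU : ℕ := linS * lcm32

/-- `aₓ ∣ lcm(1, …, 32)` for `aₓ ∈ [1, 12]`. [folklore] -/
theorem dvd_lcm32_of_le_12 {ax : ℕ} (h1 : 1 ≤ ax) (h2 : ax ≤ 12) : ax ∣ lcm32 :=
  dvd_lcm32 h1 (by omega)

/-- A `LIN` tuple that is a `TRG` tuple in form: `a₀ = 0` and a single non-zero coefficient, positive — i.e. `(p/q)·K` with
`K ∈ {π, π², π³, log 2, ζ(3), ζ(5), G}`, `1 ≤ p, q ≤ 12`, which the `TRG` table lists as `(p, q, u = 0, a ∈ {2,4,6} or (a = 0, L, s = 1))`.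
These form-coincidences (sixteen of them on the segment) are left to the `TRG` side of the machine. [folklore] -/
def linIsTrg (e : ℤ × List ℤ × ℕ) : Bool :=
  decide (e.1 = 0 ∧ (e.2.1.filter (· ≠ 0)).length = 1 ∧ ∀ y ∈ e.2.1, 0 ≤ y)

/-- The TIGHT constant table of the `LIN` side: the landed `kZ` of `ExclusionSentencesLin` (scaled integer enclosures of
`10¹⁸·K_i`) with the `log 2` entry (index `3`) read at twenty digits from the tree's `LogTwoBounds`
(`Literature.Analysis.SpecialFunctions.Real.log_two_gt_d20 / _lt_d20`) instead of Mathlib's ten-digit `Real.log_two_near_10`.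
WHY a second `LIN` table: at the landed `log 2` width (`±10⁻¹⁰`, times a coefficient up to `12`) a `LIN` enclosure can be `2·10⁻⁹`
wide and then swallows nearby `TRG` values — distinctness ACROSS the two tables is undecidable there (recog-1 gen 53: a wide
`LIN` enclosure containing a `TRG` value in the third window); `LIN` against `LIN` alone would separate at the landed width. [folklore] -/
def kZT (i : ℕ) : ℤ × ℤ :=
  if i = 3 then (693147180559945309, 693147180559945310) else kZ i

/-- Soundness of `kZT`: `(kZT i).1 ≤ 10¹⁸·K_i ≤ (kZT i).2`. [folklore] -/
theorem kZT_sound (i : ℕ) : ((kZT i).1 : ℝ) ≤ linS * k7Val i ∧ (linS : ℝ) * k7Val i ≤ (kZT i).2 := by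
  by_cases hi : i = 3
  · subst hi
    have h1 := Literature.Analysis.SpecialFunctions.Real.log_two_gt_d20
    have h2 := Literature.Analysis.SpecialFunctions.Real.log_two_lt_d20
    simp only [kZT, if_true, k7Val, linS]
    push_cast
    norm_num at h1 h2 ⊢
    constructor <;> linarith
  · simp only [kZT, if_neg hi]
    exact kZ_sound i

/-- Tight integer enclosure of `10¹⁸·Σ_j c_j K_j` (the landed `linZEncl` with `kZT`; zero coefficients skipped). [folklore] -/
def linZEnclT : ℕ → List ℤ → ℤ × ℤ
  | _, [] => (0, 0)
  | i, c :: cs =>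
      if c = 0 then linZEnclT (i + 1) cs
      else if 0 < c then (c * (kZT i).1 + (linZEnclT (i + 1) cs).1, c * (kZT i).2 + (linZEnclT (i + 1) cs).2)
      else (c * (kZT i).2 + (linZEnclT (i + 1) cs).1, c * (kZT i).1 + (linZEnclT (i + 1) cs).2)

/-- Soundness of `linZEnclT` (verbatim the landed proof of `linZEncl_sound` with `kZT`). [folklore] -/
theorem linZEnclT_sound : ∀ (i : ℕ) (c : List ℤ),
    ((linZEnclT i c).1 : ℝ) ≤ linS * lin7Val i c ∧ (linS : ℝ) * lin7Val i c ≤ (linZEnclT i c).2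
  | _, [] => by simp [linZEnclT, lin7Val]
  | i, c :: cs => by
      obtain ⟨ih1, ih2⟩ := linZEnclT_sound (i + 1) cs
      obtain ⟨hk1, hk2⟩ := kZT_sound i
      simp only [linZEnclT, lin7Val]
      split_ifs with h0 hpos
      · subst h0; simp only [Int.cast_zero, zero_mul, zero_add]; exact ⟨ih1, ih2⟩
      · have hc : (0 : ℝ) ≤ c := by exact_mod_cast hpos.le
        push_cast
        constructor
        · nlinarith [mul_le_mul_of_nonneg_left hk1 hc]
        · nlinarith [mul_le_mul_of_nonneg_left hk2 hc]
      · have hc : (c : ℝ) ≤ 0 := by exact_mod_cast (not_lt.mp hpos)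
        push_cast
        constructor
        · nlinarith [mul_le_mul_of_nonpos_left hk2 hc]
        · nlinarith [mul_le_mul_of_nonpos_left hk1 hc]

/-- The tagged scaled enclosure of a `LIN` tuple `(a₀, c, aₓ)` over the TIGHT `linZEnclT`:
`((10¹⁸a₀ + T₁)·(lcm32/aₓ), (10¹⁸a₀ + T₂)·(lcm32/aₓ), tag)`, `tag = 2` for a `TRG` form (`linIsTrg`) and `0` otherwise (ends
clipped at `0` by `toNat`; for the generated tuples both are non-negative, `linEncOf_sound`). [folklore] -/
def linEncOf (e : ℤ × List ℤ × ℕ) : Enc :=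
  (((linS : ℤ) * e.1 + (linZEnclT 0 e.2.1).1).toNat * (lcm32 / e.2.2),
    ((linS : ℤ) * e.1 + (linZEnclT 0 e.2.1).2).toNat * (lcm32 / e.2.2), if linIsTrg e then 2 else 0)

/-- The scaled value of a `LIN` tuple: `distU · (a₀ + Σcᵢ Kᵢ)/aₓ = (lcm32/aₓ)·(10¹⁸a₀ + 10¹⁸Σcᵢ Kᵢ)`.
[folklore] -/
theorem distU_mul_linVal (a0 : ℤ) (c : List ℤ) {ax : ℕ} (hax1 : 1 ≤ ax) (hax2 : ax ≤ 12) :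
    (distU : ℝ) * lin7TupleVal (a0, c, ax) =
      ((lcm32 / ax : ℕ) : ℝ) * ((linS : ℝ) * (a0 : ℝ) + (linS : ℝ) * lin7Val 0 c) := by
  set m : ℕ := lcm32 / ax with hm
  have hmax : m * ax = lcm32 := Nat.div_mul_cancel (dvd_lcm32_of_le_12 hax1 hax2)
  have hmax' : (m : ℝ) * (ax : ℝ) = (lcm32 : ℝ) := by exact_mod_cast hmax
  have hax0 : (0 : ℝ) < ax := by exact_mod_cast hax1
  have e : (distU : ℝ) = (linS : ℝ) * ((m : ℝ) * (ax : ℝ)) := by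
    rw [hmax']; unfold distU; push_cast; ring
  unfold lin7TupleVal
  simp only
  calc (distU : ℝ) * (((a0 : ℝ) + lin7Val 0 c) / (ax : ℝ))
      = (linS : ℝ) * ((m : ℝ) * (ax : ℝ)) * (((a0 : ℝ) + lin7Val 0 c) / (ax : ℝ)) := by rw [e]
    _ = (m : ℝ) * ((linS : ℝ) * (a0 : ℝ) + (linS : ℝ) * lin7Val 0 c) * ((ax : ℝ) / (ax : ℝ)) := by ring
    _ = (m : ℝ) * ((linS : ℝ) * (a0 : ℝ) + (linS : ℝ) * lin7Val 0 c) := by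
        rw [div_self hax0.ne', mul_one]

/-- **Soundness of `linEncOf`**: for a tuple with `1 ≤ aₓ ≤ 12` and `0 ≤ 10¹⁸a₀ + T₁`, the enclosure contains
`distU · value`. [folklore] -/
theorem linEncOf_sound {a0 : ℤ} {c : List ℤ} {ax : ℕ} (hax1 : 1 ≤ ax) (hax2 : ax ≤ 12)
    (hnn : 0 ≤ (linS : ℤ) * a0 + (linZEnclT 0 c).1) :
    (((linEncOf (a0, c, ax)).1 : ℕ) : ℝ) ≤ (distU : ℝ) * lin7TupleVal (a0, c, ax) ∧
      (distU : ℝ) * lin7TupleVal (a0, c, ax) ≤ (((linEncOf (a0, c, ax)).2.1 : ℕ) : ℝ) := by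
  obtain ⟨hT1, hT2⟩ := linZEnclT_sound 0 c
  set T := linZEnclT 0 c with hT
  have hnn2 : 0 ≤ (linS : ℤ) * a0 + T.2 := by
    have h12 : (T.1 : ℝ) ≤ T.2 := hT1.trans hT2
    have h12' : T.1 ≤ T.2 := by exact_mod_cast h12
    omega
  have hm0 : (0 : ℝ) ≤ ((lcm32 / ax : ℕ) : ℝ) := by positivity
  have key := distU_mul_linVal a0 c hax1 hax2
  have c1 : ((((linS : ℤ) * a0 + T.1).toNat : ℕ) : ℝ) = (linS : ℝ) * (a0 : ℝ) + (T.1 : ℝ) := by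
    have h := Int.toNat_of_nonneg hnn
    have h' : ((((linS : ℤ) * a0 + T.1).toNat : ℤ) : ℝ) = (((linS : ℤ) * a0 + T.1 : ℤ) : ℝ) := by rw [h]
    push_cast at h'
    exact h'
  have c2 : ((((linS : ℤ) * a0 + T.2).toNat : ℕ) : ℝ) = (linS : ℝ) * (a0 : ℝ) + (T.2 : ℝ) := by
    have h := Int.toNat_of_nonneg hnn2
    have h' : ((((linS : ℤ) * a0 + T.2).toNat : ℤ) : ℝ) = (((linS : ℤ) * a0 + T.2 : ℤ) : ℝ) := by rw [h]
    push_cast at h'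
    exact h'
  unfold linEncOf
  simp only
  constructor
  · rw [key]; push_cast; rw [c1]
    nlinarith [mul_le_mul_of_nonneg_left hT1 hm0]
  · rw [key]; push_cast; rw [c2]
    nlinarith [mul_le_mul_of_nonneg_left hT2 hm0]

end ColumnFaceL11
end Summit.CriticalPhenomena.Ising3D
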